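import Summits.ResolutionOfSingularities.ResolutionOfSingularities.Theorems.ValuativeLuAlphaPTorsorAdaptedDefs
import Summits.ResolutionOfSingularities.ResolutionOfSingularities.Theorems.ValuativeLuAlphaPTorsorAPDict
import Summits.ResolutionOfSingularities.ResolutionOfSingularities.Theorems.ValuativeLuAlphaPTorsorAPLift
import Literature.AlgebraicGeometry.Resolution.CompositeValuations
import Literature.AlgebraicGeometry.Resolution.TranscendenceDefect
import Mathlib.RingTheory.Ideal.Operations
import HarnessLib

/-!
# S3* level induction, step 3: the conclusions (explicit form, monomial bookkeeping, units, monomials of value ≤ 1)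

Crux `Valuative.LuAlphaPTorsor` (stmt-ResolutionOfSingularities-0641), line `pfaff-line-log-final-forms`,
lead seat c4 — `ap_adaptedPerron` split by the 400-line rule. STEP 3 (`ap_ap_step3`): with the
flag-adapted final system of steps 1–2, record the construction: `R₃ = k[R ∪ xf]`, the new
parameters are Laurent monomials in the old ones and conversely ℕ-monomials, the `a_j` are
ℕ-monomials times units (lifting the residual units and absorbing the `W`-small error by the
type-2 divisions), and the given monomials of value `≤ 1` are ℕ-monomials (the divisor exponents
`mv` absorb the negative lower parts). Anchor `ap_ap_step3_anchor`. [folklore]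
-/

set_option linter.dupNamespace false

open IsLocalRing

namespace Summit.ResolutionOfSingularities.ResolutionOfSingularities.Theorems.PfaffLine

open Literature.AlgebraicGeometry.Resolution

/-- Anchor (closed form): `W`-values are bounded by `O`-membership. [folklore] -/
theorem ap_ap_step3_anchor : ∀ {K : Type} [Field K] (O W : ValuationSubring K), O ≤ W → ∀ z : K, O.valuation z ≤ 1 → W.valuation z ≤ 1 := by
  intro K _ O W hOW z hz
  exact (W.valuation_le_one_iff z).mpr (hOW ((O.valuation_le_one_iff z).mp hz))

set_option maxHeartbeats 800000 in
/-- **STEP 3 of the induction step of S3***: the recorded construction. [folklore] -/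
theorem ap_ap_step3 {k K : Type} [Field k] [Field K] [Algebra k K] (O : ValuationSubring K)
    {n : ℕ} (R : Subalgebra k K) (hRO : R.toSubring ≤ O.toSubring)
    (x : Fin n → K) (hx : ∀ i, x i ∈ R) (lv : Fin n → ℕ) (top : ℕ) (hle : ∀ i, lv i ≤ top) (hx0 : ∀ i, x i ≠ 0)
    (W : ValuationSubring K) (hOW : O ≤ W) (hWlow : ∀ i, lv i < top → W.valuation (x i) = 1)
    (hWO : ∀ z : K, W.valuation z < 1 → O.valuation z < 1)
    {nT : ℕ} (eT : Fin nT ≃ {i : Fin n // lv i = top}) {nS : ℕ} (eS : Fin nS ≃ {i : Fin n // lv i < top})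
    (hlowW : ∀ i, lv i < top → x i ∈ W ∧ (x i)⁻¹ ∈ W)
    [Algebra k (ResidueField W)]
    (R₁ : Subalgebra k K) (xT : Fin nT → K) (hRR₁ : R ≤ R₁)
    (hind₁ : ∀ m : Fin nT → ℤ, (∏ t, W.valuation (xT t) ^ (m t)) = 1 → m = 0)
    (hxTd : ∀ t, ∃ d : Fin nT → ℕ, x (eT t) = ∏ t', xT t' ^ (d t'))
    {ma : ℕ} (a : Fin ma → K) (α₁ : Fin ma → Fin nT → ℕ) (c₁ : Fin ma → K) (hc₁R : ∀ j, c₁ j ∈ R₁)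
    (hR₁O : R₁.toSubring ≤ O.toSubring)
    (hac : ∀ j, a j = (∏ t, xT t ^ (α₁ j t)) * c₁ j)
    {l : ℕ} (h : Fin l → Fin n → ℤ)
    (hR₁eq : R₁ = Algebra.adjoin k ((R : Set K) ∪ Set.range xT))
    (hxTc : ∀ t, ∃ c : Fin nT → ℤ, xT t = ∏ t', x (eT t') ^ (c t'))
    (Rb' : Subalgebra k (ResidueField W))
    (xb' : Fin nS → ResidueField W)
    (β : Fin ma → Fin nS → ℕ) (ub : Fin ma → ResidueField W) (hubR : ∀ j, ub j ∈ Rb')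
    (hubu : ∀ j, (residueValuationSubring O W hOW).valuation (ub j) = 1)
    (hcbeq : ∀ j, residue W ⟨c₁ j, hOW (hR₁O (hc₁R j))⟩ = (∏ s, xb' s ^ (β j s)) * ub j)
    (eb : Fin l → Fin nS → ℕ)
    (heb : ∀ j, (∏ s, residue W ⟨x (eS s).1, hOW (hRO (hx (eS s).1))⟩ ^
      ((if ∀ t, h j (eT t) = 0 then (fun s => h j (eS s)) else 0 : Fin nS → ℤ) s)) = ∏ s, xb' s ^ (eb j s))
    (u : Fin nS → K) (Q : K) (B : Subalgebra k K)
    (hBW : B.toSubring ≤ W.toSubring) (hBO : B.toSubring ≤ O.toSubring) (N₀ : ℕ)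
    (tsel : Fin l → Fin nT) (e₁ : Fin l → Fin nT → ℕ) (g : Fin l → Fin nS → ℤ)
    (mv : Fin nT → Fin nS → ℕ) (bsum : Fin nS → ℕ) (dv : Fin nT → Fin nS → ℕ) (E : Fin nT → K)
    (z : Fin nT → K) (R₃ : Subalgebra k K) (hR₃O : R₃.toSubring ≤ O.toSubring)
    (hzR₃ : ∀ t, z t ∈ R₃) (hxTB : ∀ t, xT t ∈ B) (hQB : Q ∈ B)
    (hBR₃ : B ≤ R₃) (C' : Fin nS → Fin nS → ℤ) (D' : Fin nS → Fin nS → ℕ)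
    (hB : B = Algebra.adjoin k ((R₁ : Set K) ∪ Set.range u))
    (hu : u = (fun s => ∏ s1, x (eS s1) ^ (C' s s1)))
    (huu : ∀ s, W.valuation (u s) = 1) (hu0 : ∀ s, u s ≠ 0)
    (hxu : ∀ s1, x (eS s1) = ∏ s, u s ^ ((D' s1 s : ℤ)))
    (hQ0 : Q ≠ 0) (hR₁B : R₁ ≤ B)
    (hthrow : ∀ (τ : K) (hτ : τ ∈ B), W.valuation τ < 1 →
      (⟨Q ^ N₀ * τ, mul_mem (pow_mem hQB N₀) hτ⟩ : B.toSubring) ∈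
        Ideal.span (Set.range fun t => (⟨xT t, hxTB t⟩ : B.toSubring)))
    (htsel : ∀ j, (¬ ∀ t, h j (eT t) = 0) → e₁ j (tsel j) ≠ 0)
    (he₁ : ∀ j, (∏ t, x (eT t) ^ (h j (eT t))) = ∏ t, xT t ^ (e₁ j t))
    (hgmon : ∀ j, (∏ s1, x (eS s1) ^ (h j (eS s1))) = ∏ s, u s ^ (g j s))
    (hmvge : ∀ j s, (g j s).natAbs ≤ mv (tsel j) s) (hmvdv : ∀ t s, mv t s ≤ dv t s)
    (hβle : ∀ j s, β j s ≤ bsum s)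
    (hE : E = (fun t => ∏ s, u s ^ (bsum s + mv t s)))
    (hQE : ∀ t, Q ^ N₀ * E t = ∏ s, u s ^ (dv t s : ℤ))
    (hz : z = (fun t => xT t / (Q ^ N₀ * E t)))
    (hzW : ∀ t, W.valuation (z t) < 1)
    (hR₃ : R₃ = Algebra.adjoin k ((B : Set K) ∪ Set.range z))
    (hxTz : ∀ t, xT t = z t * ∏ s, u s ^ (dv t s : ℤ))
    (hsurjB : ∀ rb ∈ Rb', ∃ (w : K) (hw : w ∈ B), residue W ⟨w, hBW hw⟩ = rb)
    (humonπ : ∀ (b : Fin nS → ℕ) (hb : (∏ s, u s ^ (b s)) ∈ W), residue W ⟨∏ s, u s ^ (b s), hb⟩ = ∏ s, xb' s ^ (b s))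
    (humonB : ∀ b : Fin nS → ℕ, (∏ s, u s ^ (b s)) ∈ B)
    (xf : Fin n → K) (hxfR₃ : ∀ i, xf i ∈ R₃) (lvf : Fin n → ℕ)
    (hxf : xf = (fun i => if hi : lv i = top then z (eT.symm ⟨i, hi⟩) else u (eS.symm ⟨i, lt_of_le_of_ne (hle i) hi⟩)))
    (hxfT : ∀ t, xf (eT t) = z t) (hxfS : ∀ s, xf (eS s) = u s)
    (hflag₃ : FlagAdaptedChart O R₃ hR₃O xf hxfR₃ lvf)
    (hEXTN : ∀ (bT : Fin nT → ℕ) (bS : Fin nS → ℕ),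
      (∏ j, xf j ^ ((fun j => if hj : lv j = top then bT (eT.symm ⟨j, hj⟩) else bS (eS.symm ⟨j, lt_of_le_of_ne (hle j) hj⟩)) j)) =
        (∏ t, z t ^ (bT t)) * ∏ s, u s ^ (bS s))
    (hEXTZx : ∀ (cT : Fin nT → ℤ) (cS : Fin nS → ℤ),
      (∏ j, x j ^ ((fun j => if hj : lv j = top then cT (eT.symm ⟨j, hj⟩) else cS (eS.symm ⟨j, lt_of_le_of_ne (hle j) hj⟩)) j)) =
        (∏ t, x (eT t) ^ (cT t)) * ∏ s, x (eS s) ^ (cS s))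
    (hxvS : ∀ (ms : Fin nS → ℤ),
      (∏ j, O.valuation (xf j) ^ ((fun j => if hj : lv j = top then 0 else ms (eS.symm ⟨j, lt_of_le_of_ne (hle j) hj⟩)) j)) =
        ∏ s, O.valuation (u s) ^ (ms s)) :
    R ≤ R₃ ∧ R₃ = Algebra.adjoin k ((R : Set K) ∪ Set.range xf) ∧
      (∀ j, ∃ c : Fin n → ℤ, xf j = ∏ i, x i ^ (c i)) ∧
      (∀ i, ∃ d : Fin n → ℕ, x i = ∏ j, xf j ^ (d j)) ∧
      (∀ j, ∃ (α : Fin n → ℕ) (w : K), w ∈ R₃ ∧ O.valuation w = 1 ∧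
        a j = (∏ i, xf i ^ (α i)) * w) ∧
      (∀ j, ∃ e : Fin n → ℕ, (∏ i, x i ^ (h j i)) = ∏ i, xf i ^ (e i)) := by
  classical
  set Ob := residueValuationSubring O W hOW with hOb
  have hsplit := fun (N : Type) [CommMonoid N] (f : Fin n → N) => ap_prod_split lv top eT eS hle f
  have hmonW : ∀ m : Fin nS → ℤ, (∏ s, x (eS s) ^ (m s)) ∈ W := by
    intro m
    refine prod_mem fun s _ => ?_
    rcases Int.eq_nat_or_neg (m s) with ⟨N, hN | hN⟩
    · rw [hN, zpow_natCast]; exact pow_mem (hlowW _ (eS s).2).1 N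
    · rw [hN, zpow_neg, zpow_natCast, ← inv_pow]; exact pow_mem (hlowW _ (eS s).2).2 N
  have hmonu : ∀ m : Fin nS → ℤ, W.valuation (∏ s, x (eS s) ^ (m s)) = 1 := by
    intro m; rw [map_prod]; exact Finset.prod_eq_one fun s _ => by rw [map_zpow₀, hWlow _ (eS s).2, one_zpow]
  have hmonπ : ∀ m : Fin nS → ℤ, residue W ⟨∏ s, x (eS s) ^ (m s), hmonW m⟩ =
      ∏ s, residue W ⟨x (eS s).1, hOW (hRO (hx (eS s).1))⟩ ^ (m s) :=
    fun m => ap_residue_prod_zpow W (fun s => x (eS s)) (fun s => (hlowW _ (eS s).2).1)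
      (fun s => (hlowW _ (eS s).2).2) (fun s => hx0 _) m (hmonW m)
  -- `u`-monomials are `x_S`-monomials
  have humon : ∀ (b : Fin nS → ℤ), (∏ s, u s ^ (b s)) = ∏ s1, x (eS s1) ^ (∑ s, b s * C' s s1) := by
    intro b; rw [hu]; exact ap_prod_zpow_matrix _ (fun s1 => hx0 _) C' b
  -- (i) `R ≤ R₃`
  have hRR₃ : R ≤ R₃ := fun w hw => hBR₃ (hR₁B (hRR₁ hw))
  -- (ii) the explicit form
  have hR₃eq : R₃ = Algebra.adjoin k ((R : Set K) ∪ Set.range xf) := by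
    apply le_antisymm
    · -- `R₃ = k[B ∪ z] ≤ k[R ∪ xf]`
      have hA : ∀ w, w ∈ Set.range xf → w ∈ Algebra.adjoin k ((R : Set K) ∪ Set.range xf) :=
        fun w hw => Algebra.subset_adjoin (Or.inr hw)
      have hzA : ∀ t, z t ∈ Algebra.adjoin k ((R : Set K) ∪ Set.range xf) :=
        fun t => hA _ ⟨eT t, hxfT t⟩
      have huA : ∀ s, u s ∈ Algebra.adjoin k ((R : Set K) ∪ Set.range xf) :=
        fun s => hA _ ⟨eS s, hxfS s⟩
      have hxTA : ∀ t, xT t ∈ Algebra.adjoin k ((R : Set K) ∪ Set.range xf) := by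
        intro t; rw [hxTz t]
        refine mul_mem (hzA t) (prod_mem fun s _ => ?_)
        rw [zpow_natCast]; exact pow_mem (huA s) _
      have hR₁A : R₁ ≤ Algebra.adjoin k ((R : Set K) ∪ Set.range xf) := by
        rw [hR₁eq]; refine Algebra.adjoin_le ?_
        rintro w (hw | ⟨t, rfl⟩)
        · exact Algebra.subset_adjoin (Or.inl hw)
        · exact hxTA t
      have hBA : B ≤ Algebra.adjoin k ((R : Set K) ∪ Set.range xf) := by
        rw [hB]
        refine Algebra.adjoin_le ?_
        rintro w (hw | ⟨s, rfl⟩)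
        · exact hR₁A hw
        · exact huA s
      rw [hR₃]
      refine Algebra.adjoin_le ?_
      rintro w (hw | ⟨t, rfl⟩)
      · exact hBA hw
      · exact hzA t
    · refine Algebra.adjoin_le ?_
      rintro w (hw | ⟨i, rfl⟩)
      · exact hRR₃ hw
      · exact hxfR₃ i
  -- (iii) the new parameters are Laurent monomials in the old ones
  have hc_fin : ∀ i, ∃ c : Fin n → ℤ, xf i = ∏ j, x j ^ (c j) := by
    intro i
    by_cases hi : lv i = top
    · -- a top parameter `z t`
      set t := eT.symm ⟨i, hi⟩ with ht
      have hxi : xf i = z t := by rw [hxf]; simp only []; rw [dif_pos hi]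
      obtain ⟨cT, hcT⟩ := hxTc t
      refine ⟨fun j => if hj : lv j = top then cT (eT.symm ⟨j, hj⟩) else
        (∑ s, (-(dv t s : ℤ)) * C' s (eS.symm ⟨j, (lt_of_le_of_ne (hle j) hj)⟩)), ?_⟩
      rw [hEXTZx cT (fun s1 => ∑ s, (-(dv t s : ℤ)) * C' s s1), ← humon, hxi, hz]
      simp only []
      rw [hQE t, hcT, div_eq_mul_inv, ← Finset.prod_inv_distrib]
      congr 1
      exact Finset.prod_congr rfl fun s _ => by rw [zpow_neg]
    · -- a lower parameter `u s`
      set s₀ := eS.symm ⟨i, (lt_of_le_of_ne (hle i) hi)⟩ with hs₀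
      have hxi : xf i = u s₀ := by rw [hxf]; simp only []; rw [dif_neg hi]
      refine ⟨fun j => if hj : lv j = top then (0 : Fin nT → ℤ) (eT.symm ⟨j, hj⟩) else C' s₀ (eS.symm ⟨j, (lt_of_le_of_ne (hle j) hj)⟩), ?_⟩
      rw [hEXTZx 0 (C' s₀), hxi, hu]
      simp
  -- (iv) the old parameters are ℕ-monomials in the new ones
  choose d₁ hd₁ using hxTd
  have hd_fin : ∀ i, ∃ d : Fin n → ℕ, x i = ∏ j, xf j ^ (d j) := by
    intro i
    by_cases hi : lv i = top
    · set t := eT.symm ⟨i, hi⟩ with ht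
      have hxi : x i = x (eT t) := by rw [ht, Equiv.apply_symm_apply]
      refine ⟨fun j => if hj : lv j = top then d₁ t (eT.symm ⟨j, hj⟩) else
        (∑ t', d₁ t t' * dv t' (eS.symm ⟨j, (lt_of_le_of_ne (hle j) hj)⟩)), ?_⟩
      rw [hEXTN (d₁ t) (fun s => ∑ t', d₁ t t' * dv t' s), hxi, hd₁ t]
      simp_rw [hxTz]
      rw [Finset.prod_congr rfl (fun t' _ => mul_pow (z t') (∏ s, u s ^ (dv t' s : ℤ)) (d₁ t t')),
        Finset.prod_mul_distrib]
      congr 1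
      -- `∏_{t'} (∏_s u^{dv t' s})^{d₁ t t'} = ∏_s u^{∑ d₁ dv}`
      have : ∀ t', (∏ s, u s ^ (dv t' s : ℤ)) ^ (d₁ t t') = ∏ s, u s ^ ((d₁ t t' : ℤ) * dv t' s) := by
        intro t'; rw [← zpow_natCast, ap_prod_zpow_zpow]
      simp_rw [this]
      rw [Finset.prod_comm]
      refine Finset.prod_congr rfl fun s _ => ?_
      rw [← ap_zpow_sum _ _ (hu0 s), ← zpow_natCast]
      congr 1; push_cast; rfl
    · set s1 := eS.symm ⟨i, (lt_of_le_of_ne (hle i) hi)⟩ with hs1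
      have hxi : x i = x (eS s1) := by rw [hs1, Equiv.apply_symm_apply]
      refine ⟨fun j => if hj : lv j = top then (0 : Fin nT → ℕ) (eT.symm ⟨j, hj⟩) else D' s1 (eS.symm ⟨j, (lt_of_le_of_ne (hle j) hj)⟩), ?_⟩
      rw [hEXTN 0 (D' s1), hxi, hxu s1]
      simp only [Pi.zero_apply, pow_zero, Finset.prod_const_one, one_mul]
      exact Finset.prod_congr rfl fun s _ => zpow_natCast _ _
  -- (v) the `a j`
  have ha_fin : ∀ j, ∃ (αf : Fin n → ℕ) (w : K), w ∈ R₃ ∧ O.valuation w = 1 ∧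
      a j = (∏ i, xf i ^ (αf i)) * w := by
    intro j
    obtain ⟨w, hwB, hπw⟩ := hsurjB (ub j) (hubR j)
    -- `w` is an `O`-unit
    have hwu : W.valuation w = 1 := by
      by_contra h1
      have hlt : W.valuation w < 1 := lt_of_le_of_ne ((W.valuation_le_one_iff _).mpr (hBW hwB)) h1
      have h0 : residue W ⟨w, hBW hwB⟩ = 0 := (ap_residue_eq_zero_iff W _).mpr hlt
      rw [hπw] at h0
      have := hubu j
      rw [h0, map_zero] at this
      exact zero_ne_one this
    have hwv : O.valuation w = 1 := by
      have h1 : ¬ Ob.valuation (residue W ⟨w, hBW hwB⟩) < 1 := by rw [hπw, hubu j]; exact lt_irrefl _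
      rw [ap_resval_lt_one_iff O W hOW (hBW hwB) hwu] at h1
      exact le_antisymm ((O.valuation_le_one_iff _).mpr (hBO hwB)) (not_lt.mp h1)
    -- the difference `δ = c₁ j - u^β w` is `W`-small
    set uβ : K := ∏ s, u s ^ (β j s) with huβ
    have huβB : uβ ∈ B := humonB _
    have huβ0 : uβ ≠ 0 := Finset.prod_ne_zero_iff.mpr fun s _ => pow_ne_zero _ (hu0 s)
    set δ : K := c₁ j - uβ * w with hδ
    have hδB : δ ∈ B := B.sub_mem (hR₁B (hc₁R j)) (B.mul_mem huβB hwB)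
    have hδW : W.valuation δ < 1 := by
      rw [← ap_residue_eq_zero_iff W (hBW hδB)]
      have : (⟨δ, hBW hδB⟩ : W) = ⟨c₁ j, hOW (hR₁O (hc₁R j))⟩ - ⟨uβ, hBW huβB⟩ * ⟨w, hBW hwB⟩ := rfl
      rw [this, map_sub, map_mul, humonπ _ (hBW huβB), hπw, hcbeq j, sub_self]
    obtain ⟨γ, hγ⟩ := Ideal.mem_span_range_iff_exists_fun.mp (hthrow δ hδB hδW)
    have hγK : (∑ t, (γ t : K) * xT t) = Q ^ N₀ * δ := by
      have := congrArg (fun w : B.toSubring => (w : K)) hγ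
      simp only [AddSubmonoidClass.coe_finsetSum, Subring.coe_mul] at this
      exact this
    -- `E t = u^β F t`
    set F : Fin nT → K := fun t => ∏ s, u s ^ (bsum s - β j s + mv t s) with hF
    have hFB : ∀ t, F t ∈ B := fun t => humonB _
    have hEF : ∀ t, E t = uβ * F t := by
      intro t
      rw [hE, huβ, hF]
      simp only []
      rw [← Finset.prod_mul_distrib]
      refine Finset.prod_congr rfl fun s _ => ?_
      rw [← pow_add]; congr 1; have := hβle j s; omega
    have hδeq : δ = uβ * ∑ t, (γ t : K) * z t * F t := by
      have hQN : Q ^ N₀ ≠ 0 := pow_ne_zero _ hQ0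
      have h1 : δ = (Q ^ N₀)⁻¹ * ∑ t, (γ t : K) * xT t := by
        rw [hγK, ← mul_assoc, inv_mul_cancel₀ hQN, one_mul]
      rw [h1, Finset.mul_sum, Finset.mul_sum]
      refine Finset.sum_congr rfl fun t _ => ?_
      rw [hxTz t, ← hQE t, hEF t]
      field_simp
    set w' : K := w + ∑ t, (γ t : K) * z t * F t with hw'
    have hw'R : w' ∈ R₃ := by
      refine R₃.add_mem (hBR₃ hwB) (R₃.sum_mem fun t _ => ?_)
      exact R₃.mul_mem (R₃.mul_mem (hBR₃ (γ t).2) (hzR₃ t)) (hBR₃ (hFB t))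
    have hσW : W.valuation (∑ t, (γ t : K) * z t * F t) < 1 := by
      refine Valuation.map_sum_lt _ one_ne_zero fun t _ => ?_
      rw [map_mul, map_mul]
      have h1 : W.valuation (γ t : K) ≤ 1 := (W.valuation_le_one_iff _).mpr (hBW (γ t).2)
      have h2 : W.valuation (F t) ≤ 1 := (W.valuation_le_one_iff _).mpr (hBW (hFB t))
      calc W.valuation (γ t : K) * W.valuation (z t) * W.valuation (F t)
          ≤ 1 * W.valuation (z t) * 1 := by gcongr
        _ = W.valuation (z t) := by rw [one_mul, mul_one]
        _ < 1 := hzW t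
    have hw'v : O.valuation w' = 1 := by
      have hlt : O.valuation (∑ t, (γ t : K) * z t * F t) < O.valuation w := by
        rw [hwv]; exact hWO _ hσW
      rw [hw', Valuation.map_add_eq_of_lt_left _ hlt, hwv]
    have hc₁eq : c₁ j = uβ * w' := by
      have : c₁ j = δ + uβ * w := by rw [hδ]; ring
      rw [this, hδeq, hw']; ring
    refine ⟨fun i => if hi : lv i = top then α₁ j (eT.symm ⟨i, hi⟩) else
      (∑ t, α₁ j t * dv t (eS.symm ⟨i, (lt_of_le_of_ne (hle i) hi)⟩) + β j (eS.symm ⟨i, (lt_of_le_of_ne (hle i) hi)⟩)), w', hw'R, hw'v, ?_⟩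
    rw [hEXTN (α₁ j) (fun s => ∑ t, α₁ j t * dv t s + β j s), hac j, hc₁eq]
    have h1 : ∀ t, xT t ^ (α₁ j t) = z t ^ (α₁ j t) * ∏ s, u s ^ ((α₁ j t : ℤ) * dv t s) := by
      intro t; rw [hxTz t, mul_pow, ← zpow_natCast (∏ s, u s ^ (dv t s : ℤ)), ap_prod_zpow_zpow]
    rw [Finset.prod_congr rfl (fun t _ => h1 t), Finset.prod_mul_distrib, huβ, Finset.prod_comm]
    have h2 : ∀ s, (∏ t, u s ^ ((α₁ j t : ℤ) * dv t s)) * u s ^ (β j s) = u s ^ (∑ t, α₁ j t * dv t s + β j s) := by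
      intro s
      rw [← ap_zpow_sum _ _ (hu0 s), ← zpow_natCast (u s) (β j s), ← zpow_add₀ (hu0 s), ← zpow_natCast]
      congr 1; push_cast; rfl
    rw [mul_assoc, mul_assoc]
    congr 1
    rw [← mul_assoc, ← Finset.prod_mul_distrib]
    congr 1
    exact Finset.prod_congr rfl fun s _ => h2 s
  -- (vi) the `h j`
  -- independence of the `u`-values (from the flag-adapted final chart)
  have huind : ∀ m : Fin nS → ℤ, (∏ s, O.valuation (u s) ^ (m s)) = 1 → m = 0 := by
    intro m hm
    have hind₃ := hflag₃.1.2.2.2.1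
    rw [← hxvS m] at hm
    have h2 := hind₃ _ hm
    funext s
    have := congrFun h2 (eS s)
    have hs : ¬ lv ((eS s : {i : Fin n // lv i < top}) : Fin n) = top := (eS s).2.ne
    simp only [Pi.zero_apply] at this
    rw [dif_neg hs] at this
    have hss : eS.symm ⟨(eS s : Fin n), lt_of_le_of_ne (hle _) hs⟩ = s := by apply eS.injective; rw [Equiv.apply_symm_apply]
    rw [hss] at this
    exact this
  have hh_fin : ∀ j, ∃ e : Fin n → ℕ, (∏ i, x i ^ (h j i)) = ∏ i, xf i ^ (e i) := by
    intro j
    -- `x^{h j} = z^{e₁ j} u^{G}`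
    set G : Fin nS → ℤ := fun s => ∑ t, (e₁ j t : ℤ) * dv t s + g j s with hG
    have hmon : (∏ i, x i ^ (h j i)) = (∏ t, z t ^ (e₁ j t)) * ∏ s, u s ^ (G s) := by
      rw [hsplit _ (fun i => x i ^ (h j i)), he₁ j, hgmon j]
      have h1 : ∀ t, xT t ^ (e₁ j t) = z t ^ (e₁ j t) * ∏ s, u s ^ ((e₁ j t : ℤ) * dv t s) := by
        intro t; rw [hxTz t, mul_pow, ← zpow_natCast (∏ s, u s ^ (dv t s : ℤ)), ap_prod_zpow_zpow]
      rw [Finset.prod_congr rfl (fun t _ => h1 t), Finset.prod_mul_distrib, Finset.prod_comm, mul_assoc,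
        ← Finset.prod_mul_distrib]
      congr 1
      refine Finset.prod_congr rfl fun s _ => ?_
      rw [← ap_zpow_sum _ _ (hu0 s), ← zpow_add₀ (hu0 s)]
    -- `G ≥ 0`
    have hGnn : ∀ s, 0 ≤ G s := by
      intro s
      by_cases hjT : ∀ t, h j (eT t) = 0
      · -- pure lower: `e₁ j = 0` and `g j = eb j ≥ 0`
        have he0 : ∀ t, e₁ j t = 0 := by
          have h1 : (∏ t, W.valuation (xT t) ^ ((e₁ j t : ℤ))) = 1 := by
            have h2 : (∏ t, xT t ^ (e₁ j t)) = 1 := by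
              rw [← he₁ j]; exact Finset.prod_eq_one fun t _ => by rw [hjT t, zpow_zero]
            have : W.valuation (∏ t, xT t ^ (e₁ j t)) = ∏ t, W.valuation (xT t) ^ ((e₁ j t : ℤ)) := by
              rw [map_prod]; exact Finset.prod_congr rfl fun t _ => by rw [map_pow, zpow_natCast]
            rw [← this, h2, map_one]
          have := hind₁ (fun t => (e₁ j t : ℤ)) h1
          intro t; have h := congrFun this t; simpa using h
        have hgeb : g j = fun s => (eb j s : ℤ) := by
          -- compare the values of `x_S^{h_S} = u^{g j}` and `u^{eb j}` through their residues
          have hres1 : residue W ⟨∏ s, x (eS s) ^ (h j (eS s)), hmonW _⟩ =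
              residue W ⟨∏ s, u s ^ (eb j s), hBW (humonB _)⟩ := by
            rw [hmonπ, humonπ, ← heb j]
            refine Finset.prod_congr rfl fun s _ => ?_
            congr 1
            rw [if_pos hjT]
          have hBu : W.valuation (∏ s, u s ^ (eb j s)) = 1 := by
            rw [map_prod]; exact Finset.prod_eq_one fun s _ => by rw [map_pow, huu, one_pow]
          have hval : O.valuation (∏ s, x (eS s) ^ (h j (eS s))) = O.valuation (∏ s, u s ^ (eb j s)) := by
            have h := (ap_resval_eq_iff O W hOW (hmonW fun s => h j (eS s)) (hBW (humonB _)) (hmonu _) hBu).mp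
              (by rw [hres1])
            exact h
          rw [hgmon j, map_prod, map_prod] at hval
          have hval' : (∏ s, O.valuation (u s) ^ (g j s)) = ∏ s, O.valuation (u s) ^ ((eb j s : ℤ)) := by
            convert hval using 2 with s _ s _
            · rw [map_zpow₀]
            · rw [map_pow, zpow_natCast]
          exact ap_exp_eq_of_prod_eq _ (fun s => (map_ne_zero _).mpr (hu0 s)) huind _ _ hval'
        rw [hG]; simp only []
        rw [show (∑ t, (e₁ j t : ℤ) * dv t s) = 0 from Finset.sum_eq_zero fun t _ => by rw [he0 t]; simp,
          zero_add, hgeb]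
        exact Int.natCast_nonneg _
      · have h1 : e₁ j (tsel j) ≠ 0 := htsel j hjT
        have h2 : (g j s).natAbs ≤ mv (tsel j) s := hmvge j s
        have h3 : mv (tsel j) s ≤ dv (tsel j) s := hmvdv (tsel j) s
        have h4 : (e₁ j (tsel j) : ℤ) * dv (tsel j) s ≤ ∑ t, (e₁ j t : ℤ) * dv t s :=
          Finset.single_le_sum (f := fun t => (e₁ j t : ℤ) * dv t s) (fun t _ => by positivity) (Finset.mem_univ _)
        have h5 : (1 : ℤ) ≤ e₁ j (tsel j) := by have := Nat.pos_of_ne_zero h1; omega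
        have h6 : ((g j s).natAbs : ℤ) ≤ dv (tsel j) s := by exact_mod_cast h2.trans h3
        rw [hG]; simp only []
        have h7 : (dv (tsel j) s : ℤ) ≤ (e₁ j (tsel j) : ℤ) * dv (tsel j) s := le_mul_of_one_le_left (by positivity) h5
        have h8 : -(g j s) ≤ (g j s).natAbs := by
          rw [← Int.natAbs_neg]; exact Int.le_natAbs
        linarith
    refine ⟨fun i => if hi : lv i = top then e₁ j (eT.symm ⟨i, hi⟩) else (G (eS.symm ⟨i, (lt_of_le_of_ne (hle i) hi)⟩)).toNat, ?_⟩
    rw [hEXTN (e₁ j) (fun s => (G s).toNat), hmon]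
    congr 1
    exact Finset.prod_congr rfl fun s _ => by rw [← zpow_natCast, Int.toNat_of_nonneg (hGnn s)]
  exact ⟨hRR₃, hR₃eq, hc_fin, hd_fin, ha_fin, hh_fin⟩

end Summit.ResolutionOfSingularities.ResolutionOfSingularities.Theorems.PfaffLine
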